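import Literature.AlgebraicGeometry.Frobenioids.BaseDivRigidity
import Literature.AlgebraicGeometry.Frobenioids.BaseCategoryTheoreticityDefs
import Literature.AlgebraicGeometry.Frobenioids.IsotropicFrobenioid
import Literature.AlgebraicGeometry.Frobenioids.RigiditySlimness
import HarnessLib

/-!
# Frobenioids I, Corollary 4.11 (i) — rigidity of `C^istr → C^un-tr` over a Div-slim base

Mochizuki, *The geometry of Frobenioids I: the general theory*, Kyushu J. Math. **62** (2008)
293–400, kurims text proof of Cor. 4.11 (i) p. 93: "The rigidity assertion … follows by observing that if
`α ∈ Aut(C_i → C_i^un-tr)`, then every automorphism [of an object of `C_i^un-tr`] induced by `α` is a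
Div-identity automorphism. [Indeed, this follows by applying the functoriality of `α` to [co-angular]
pre-steps …] … Thus, since `D_i` is Div-slim, it follows that every automorphism induced by `α` is a
base-identity automorphism, hence trivial [since `C_i^un-tr` is of unit-trivial type]"
[cite: MochizukiFrdI2008, Cor. 4.11 (i) p.93].

PROOF-ONLY, for a Frobenioid `C → F_Φ` (`IsFrobenioid`, operations `ofFunctor`) over a Div-slim base, with
`C^un-tr` the quotient category of seat abc-iut-L1-t3 (`PreFrobenioidData.Untr`, `toUntr`):

* `map_hom_eq_id_of_mem_unitsSubgroup`, `map_hom_eq_of_unitEquiv`, `map_hom_eq_of_toUntr_map_eq`: the functor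
  `C^istr → C → F_Φ` kills units, hence descends to `C^un-tr` (quotient universal property), so arrows of
  `C^istr` with the same class in `C^un-tr` have the same image `(Base, Div, deg_Fr)` in `F_Φ`;
* `isRigidFunctor_toUntr`: the natural functor `C^istr → C^un-tr` is RIGID — the components of an automorphism
  are represented by automorphisms `a_A` (isometric pre-steps out of isotropic objects), functoriality along
  arrows of `C^istr` makes `Base(a_A)` act trivially on divisors, the Div-rigidity of `C^istr → D`
  (`BaseDivRigidity`, applied to the Frobenioid `C^istr`, Prop. 1.9 (v)) makes each `a_A` a base-identity
  automorphism, i.e. a unit, i.e. trivial in `C^un-tr`;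
* `isRigidFunctor_comp_toUntr`: hence `T ⋙ (C^istr → C^un-tr)` is rigid for every equivalence `T` — the
  rigidity input of `UnitTrivialisationFunctoriality.cor411i_of_units`.

No statement of the paper is strengthened; nothing here is specific to the abc programme.
-/

namespace Literature.AlgebraicGeometry.Frobenioids

open CategoryTheory Opposite

universe w v v' u u' v₁ u₁

namespace PreFrobenioid

variable {D : Type u} [Category.{v} D] {Φ : Dᵒᵖ ⥤ CommMonCat.{w}}
  {C : Type u'} [Category.{v'} C] {F : C ⥤ ElemFrobenioid Φ}

/-- A unit `δ ∈ O^×(A)` maps to the identity of `F_Φ` (base-identity, linear, and an isometry since it is an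
isomorphism). [cite: MochizukiFrdI2008, Def. 3.1 (iv) p.57] -/
theorem map_hom_eq_id_of_mem_unitsSubgroup (hF : IsFrobenioid F) {A : C} (δ : Aut A)
    (hδ : δ ∈ unitsSubgroup F A) : F.map δ.hom = 𝟙 (F.obj A) := by
  obtain ⟨hb, hl⟩ := hδ
  have hd : Div F δ.hom = 1 := isIsometry_of_isIso F hF.isPreFrobenioid δ.hom
  apply ElemFrobenioid.Hom.ext
  · exact hb
  · exact hd
  · exact hl

/-- Unit-equivalent arrows of `C^istr` have the same image in `F_Φ`. [cite: MochizukiFrdI2008, Def. 3.1 (iv) p.57] -/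
theorem map_hom_eq_of_unitEquiv (hF : IsFrobenioid F) {A B : (PreFrobenioidData.ofFunctor Φ F).Istr}
    (α₁ α₂ : A ⟶ B) (h : (PreFrobenioidData.ofFunctor Φ F).UnitEquiv α₁ α₂) : F.map α₁.hom = F.map α₂.hom := by
  obtain ⟨X, γ, β, δ, hδ, rfl, rfl⟩ := h
  show F.map (γ.hom ≫ β.hom) = F.map (γ.hom ≫ δ.hom ≫ β.hom)
  rw [F.map_comp, F.map_comp, F.map_comp, map_hom_eq_id_of_mem_unitsSubgroup hF δ hδ, Category.id_comp]

/-- Arrows of `C^istr` with the same class in `C^un-tr` have the same image in `F_Φ`: the functor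
`C^istr → F_Φ` descends to the quotient `C^un-tr` (universal property of the quotient category).
[cite: MochizukiFrdI2008, Def. 3.1 (iv) p.57] -/
theorem map_hom_eq_of_toUntr_map_eq (hF : IsFrobenioid F) {A B : (PreFrobenioidData.ofFunctor Φ F).Istr}
    (x y : A ⟶ B) (h : (PreFrobenioidData.ofFunctor Φ F).toUntr.map x = (PreFrobenioidData.ofFunctor Φ F).toUntr.map y) :
    F.map x.hom = F.map y.hom := by
  let L : (PreFrobenioidData.ofFunctor Φ F).Untr ⥤ ElemFrobenioid Φ :=
    CategoryTheory.Quotient.lift _ ((PreFrobenioidData.ofFunctor Φ F).istrι ⋙ F)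
      fun _ _ f g hfg => map_hom_eq_of_unitEquiv hF f g hfg
  have hx : L.map ((PreFrobenioidData.ofFunctor Φ F).toUntr.map x) = F.map x.hom :=
    CategoryTheory.Quotient.lift_map_functor_map _ _ _ x
  have hy : L.map ((PreFrobenioidData.ofFunctor Φ F).toUntr.map y) = F.map y.hom :=
    CategoryTheory.Quotient.lift_map_functor_map _ _ _ y
  rw [← hx, ← hy, h]

/-- **Rigidity of `C^istr → C^un-tr`** over a Div-slim base (FrdI proof of Cor. 4.11 (i) p. 93): every
automorphism of the natural functor from the isotropic objects of a Frobenioid to its unit-trivialisation is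
the identity. [cite: MochizukiFrdI2008, Cor. 4.11 (i) p.93] -/
theorem isRigidFunctor_toUntr (hF : IsFrobenioid F) (hds : (PreFrobenioidData.ofFunctor Φ F).IsDivSlim) :
    IsRigidFunctor (PreFrobenioidData.ofFunctor Φ F).toUntr := by
  intro α
  have hP := hF.isPreFrobenioid
  -- representatives `a A`, `b A` of the components of `α`, `α⁻¹`
  have hrep : ∀ A : (PreFrobenioidData.ofFunctor Φ F).Istr, ∃ a : A ⟶ A,
      (PreFrobenioidData.ofFunctor Φ F).toUntr.map a = α.hom.app A := fun A =>
    ⟨(PreFrobenioidData.ofFunctor Φ F).toUntr.preimage (α.hom.app A), Functor.map_preimage _ _⟩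
  have hrep' : ∀ A : (PreFrobenioidData.ofFunctor Φ F).Istr, ∃ b : A ⟶ A,
      (PreFrobenioidData.ofFunctor Φ F).toUntr.map b = α.inv.app A := fun A =>
    ⟨(PreFrobenioidData.ofFunctor Φ F).toUntr.preimage (α.inv.app A), Functor.map_preimage _ _⟩
  choose a ha using hrep
  choose b hb using hrep'
  -- `a A ≫ b A` and `b A ≫ a A` have the class of the identity, hence the image of the identity in `F_Φ`
  have hab : ∀ A, F.map ((a A).hom ≫ (b A).hom) = 𝟙 (F.obj A.obj) := fun A => by
    have h := map_hom_eq_of_toUntr_map_eq hF (a A ≫ b A) (𝟙 A)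
      (by rw [Functor.map_comp, ha, hb, Iso.hom_inv_id_app, CategoryTheory.Functor.map_id])
    rw [← F.map_id]
    exact h
  have hba : ∀ A, F.map ((b A).hom ≫ (a A).hom) = 𝟙 (F.obj A.obj) := fun A => by
    have h := map_hom_eq_of_toUntr_map_eq hF (b A ≫ a A) (𝟙 A)
      (by rw [Functor.map_comp, ha, hb, Iso.inv_hom_id_app, CategoryTheory.Functor.map_id])
    rw [← F.map_id]
    exact h
  -- hence `a A` is an isometric pre-step out of an isotropic object, i.e. an isomorphism
  have hdeg : ∀ A, degFr F (a A).hom = 1 := fun A => by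
    have h : degFr F (a A).hom * degFr F (b A).hom = 1 := by
      have := congrArg ElemFrobenioid.Hom.degFr (hab A)
      rw [F.map_comp] at this
      exact this
    have h' : (degFr F (a A).hom : ℕ) * (degFr F (b A).hom : ℕ) = 1 := by exact_mod_cast congrArg PNat.val h
    exact PNat.coe_eq_one_iff.mp (Nat.eq_one_of_mul_eq_one_right h')
  have hdeg' : ∀ A, degFr F (b A).hom = 1 := fun A => by
    have h : degFr F (b A).hom * degFr F (a A).hom = 1 := by
      have := congrArg ElemFrobenioid.Hom.degFr (hba A)
      rw [F.map_comp] at this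
      exact this
    have h' : (degFr F (b A).hom : ℕ) * (degFr F (a A).hom : ℕ) = 1 := by exact_mod_cast congrArg PNat.val h
    exact PNat.coe_eq_one_iff.mp (Nat.eq_one_of_mul_eq_one_right h')
  have hbase : ∀ A, IsIso (Base F (a A).hom) := fun A => by
    have h1 : Base F (a A).hom ≫ Base F (b A).hom = 𝟙 _ := by
      have := congrArg ElemFrobenioid.Hom.base (hab A)
      rw [F.map_comp] at this
      exact this
    have h2 : Base F (b A).hom ≫ Base F (a A).hom = 𝟙 _ := by
      have := congrArg ElemFrobenioid.Hom.base (hba A)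
      rw [F.map_comp] at this
      exact this
    exact ⟨⟨Base F (b A).hom, h1, h2⟩⟩
  have hdiv : ∀ A, Div F (a A).hom = 1 := fun A => by
    have h : Frobenioids.pull Φ (Base F (a A).hom) (Div F (b A).hom) * Div F (a A).hom ^ (degFr F (b A).hom : ℕ) = 1 := by
      have := congrArg ElemFrobenioid.Hom.div (hab A)
      rw [F.map_comp] at this
      exact this
    rw [hdeg', PNat.one_coe, pow_one] at h
    exact (hP.isDivisorial (baseObj F A.obj)).isSharp.eq_one_of_isUnit _ (IsUnit.of_mul_eq_one_right _ h)
  have hiso : ∀ A, IsIso (a A).hom := fun A =>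
    (PreFrobenioidData.ofFunctor_isIsotropic F A.obj).1 A.property (a A).hom (hdiv A) ⟨hdeg A, hbase A⟩
  -- functoriality of `α` along an arrow `φ` of `C^istr`: same image in `F_Φ` for `φ ≫ a B` and `a A ≫ φ`
  have hnat : ∀ {A B : (PreFrobenioidData.ofFunctor Φ F).Istr} (φ : A ⟶ B),
      F.map (φ.hom ≫ (a B).hom) = F.map ((a A).hom ≫ φ.hom) := fun {A B} φ =>
    map_hom_eq_of_toUntr_map_eq hF (φ ≫ a B) (a A ≫ φ)
      (by rw [Functor.map_comp, Functor.map_comp, ha, ha]; exact α.hom.naturality φ)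
  have hnat_base : ∀ {A B : (PreFrobenioidData.ofFunctor Φ F).Istr} (φ : A ⟶ B),
      Base F φ.hom ≫ Base F (a B).hom = Base F (a A).hom ≫ Base F φ.hom := fun φ => by
    have := congrArg ElemFrobenioid.Hom.base (hnat φ)
    rw [F.map_comp, F.map_comp] at this
    exact this
  have hnat_div : ∀ {A B : (PreFrobenioidData.ofFunctor Φ F).Istr} (φ : A ⟶ B),
      Frobenioids.pull Φ (Base F (a A).hom) (Div F φ.hom) = Div F φ.hom := fun {A B} φ => by
    have h := congrArg ElemFrobenioid.Hom.div (hnat φ)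
    rw [F.map_comp, F.map_comp] at h
    change Frobenioids.pull Φ (Base F φ.hom) (Div F (a B).hom) * Div F φ.hom ^ (degFr F (a B).hom : ℕ) =
      Frobenioids.pull Φ (Base F (a A).hom) (Div F φ.hom) * Div F (a A).hom ^ (degFr F φ.hom : ℕ) at h
    rw [hdiv, hdiv, map_one, one_mul, one_pow, mul_one, hdeg, PNat.one_coe, pow_one] at h
    exact h.symm
  -- the Frobenioid `C^istr` (Prop. 1.9 (v)) and the comparison of the two renderings of `C^istr`
  have hle : isotropicObjects F ≤ (PreFrobenioidData.ofFunctor Φ F).isotropicObjects :=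
    fun X hX => (PreFrobenioidData.ofFunctor_isIsotropic F X).2 hX
  let j : Istr F ⥤ (PreFrobenioidData.ofFunctor Φ F).Istr := ObjectProperty.ιOfLE hle
  have hFi : IsFrobenioid (istrFunctor F) := isFrobenioid_istr hF
  have hdsi : (PreFrobenioidData.ofFunctor Φ (istrFunctor F)).IsDivSlim := ⟨hds.eq_one⟩
  -- the natural automorphism `Base(a_•)` of `C^istr → D`, acting trivially on divisors, is trivial
  let β : baseFunctor (istrFunctor F) ≅ baseFunctor (istrFunctor F) :=
    NatIso.ofComponents (fun Y => @asIso _ _ _ _ (Base F (a (j.obj Y)).hom) (hbase (j.obj Y)))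
      (fun {Y Y'} ψ => hnat_base (j.map ψ))
  have hβ : β = Iso.refl _ := by
    refine baseFunctor_iso_eq_refl_of_isDivSlim hFi hdsi β fun Y => ?_
    exact pull_eq_self_of_pull_div_eq hFi (Base F (a (j.obj Y)).hom) fun Y' ψ => hnat_div (j.map ψ)
  -- hence every `a A` is a base-identity automorphism, i.e. a unit, i.e. trivial in `C^un-tr`
  have hbid : ∀ A : (PreFrobenioidData.ofFunctor Φ F).Istr, Base F (a A).hom = 𝟙 _ := fun A => by
    have hA : IsIsotropic F A.obj := (PreFrobenioidData.ofFunctor_isIsotropic F A.obj).1 A.property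
    have := congrArg (fun i : baseFunctor (istrFunctor F) ≅ baseFunctor (istrFunctor F) => i.hom.app ⟨A.obj, hA⟩) hβ
    exact this
  ext A
  haveI := hiso A
  have hunit : asIso (a A).hom ∈ unitsSubgroup F A.obj := ⟨hbid A, hdeg A⟩
  have hequiv : (PreFrobenioidData.ofFunctor Φ F).UnitEquiv (𝟙 A) (a A) :=
    ⟨A, 𝟙 A, 𝟙 A, asIso (a A).hom, hunit, (Category.id_comp _).symm, by
      rw [Category.id_comp, Category.comp_id]
      rfl⟩
  rw [← ha A, ← CategoryTheory.Quotient.sound _ hequiv, CategoryTheory.Functor.map_id]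
  rfl

section Equivalence

variable {C₁ : Type u₁} [Category.{v₁} C₁]

/-- Hence `T ⋙ (C^istr → C^un-tr)` is rigid for every equivalence `T : C₁' ⥲ C^istr` — the rigidity input
of `UnitTrivialisationFunctoriality.cor411i_of_units` / `cor411i_restrict_of_rigid` for Frobenioids over
Div-slim bases (FrdI Cor. 4.11 (i), "each of the composite functors … is rigid").
[cite: MochizukiFrdI2008, Cor. 4.11 (i) p.93] -/
theorem isRigidFunctor_comp_toUntr (hF : IsFrobenioid F) (hds : (PreFrobenioidData.ofFunctor Φ F).IsDivSlim)
    (T : C₁ ⥤ (PreFrobenioidData.ofFunctor Φ F).Istr) [T.IsEquivalence] :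
    IsRigidFunctor (T ⋙ (PreFrobenioidData.ofFunctor Φ F).toUntr) :=
  IsRigidFunctor.comp_of_isEquivalence T (isRigidFunctor_toUntr hF hds)

end Equivalence

end PreFrobenioid

end Literature.AlgebraicGeometry.Frobenioids
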